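import Literature.Computability.Complexity.OracleQueryMap
import HarnessLib

/-!
# Clocking an oracle algorithm by a bound read off its input (transcript model)

Trunk `CplxCore`, companion of `OracleQueryMap.lean`. There `OracleAlg.clock M q b₀` stops the
oracle algorithm `M` after `q(|w|)` rounds, `w` its input. An *oracle adversary*
(`Cryptography/OracleGames.lean`) has its round budget `fuel(|x|)` in the length of the GAME
input `x` while its step function reads the pair `w = ⟨x, r⟩` of input and coins; to re-clock
such an algorithm inside another one (e.g. when its input is re-coded and its coins are cut out
of a longer coin string, as in precision doubling of samplers) the clock must be read off the
FIRST COMPONENT of `w`. This file provides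

* `OracleAlg.clockBy M t b₀` — stop after `t w` rounds for an arbitrary bound `t` (the tree's
  `clock` is `clockBy (q ∘ length)`, `clock_eq_clockBy`); `runAux_clockBy`, `run_clockBy`: with
  fuel `n > t w` the clocked algorithm outputs `(M.run O (t w) w).getD b₀` — `M`'s output within
  `t w` rounds, or the default `b₀` if `M` has not halted by then (this identifies the output in
  the exhausted case, complementing `run_clock_of_run` / `run_clock_isSome`);
* `OracleAlg.clockFst M q b₀ := clockBy (fun w => q(|(boolUnpair w).1|)) b₀` and
  `isPolyTime_clockFst`: polynomial time is preserved (the stage decomposition of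
  `OracleQueryMap.lean`, with the test `cClk q` precomposed with `mapFstFn boolUnpair.1`).

## References

* S. Arora, B. Barak, *Computational Complexity: A Modern Approach*, CUP 2009, §3.4 (oracle
  machines) with §1.4.1 (clocked simulation: time bounds enforced by a counter).
-/

namespace Literature.Computability.Complexity

open _root_.Computability PrePost EmptySim

namespace OracleAlg

variable {β : Type}

/-! ### Clocking by an arbitrary bound -/

section ClockBy

/-- **The algorithm clocked by `t`**: `M.clockBy t b₀` behaves as `M` for `t w` rounds on input
`w` and then outputs the default `b₀`. (Arora–Barak 2009, §3.4 with §1.4.1: the time bound of an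
oracle machine is enforced by a clock, independently of the oracle.) [cite: AroraBarak2009, §3.4] -/
def clockBy (M : OracleAlg β) (t : List Bool → ℕ) (b₀ : β) : OracleAlg β where
  step w as := if as.length < t w then M.step w as else Sum.inr b₀

/-- The step of `M.clockBy t b₀` (definitional). [folklore] -/
theorem clockBy_step (M : OracleAlg β) (t : List Bool → ℕ) (b₀ : β) (w : List Bool)
    (as : List (List Bool)) :
    (M.clockBy t b₀).step w as = if as.length < t w then M.step w as else Sum.inr b₀ :=
  rfl

/-- The tree's `clock` is `clockBy` with the bound `q(|w|)`. [folklore] -/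
theorem clock_eq_clockBy (M : OracleAlg β) (q : Polynomial ℕ) (b₀ : β) :
    M.clock q b₀ = M.clockBy (fun w => q.eval w.length) b₀ :=
  rfl

/-- **The output of the clocked algorithm.** Along a transcript growing by one answer per round,
with more fuel than the clock leaves, `M.clockBy t b₀` outputs what `M` outputs within the
remaining `t w - |as|` rounds, and `b₀` if `M` does not halt by then. [cite: AroraBarak2009, §3.4] -/
theorem runAux_clockBy (M : OracleAlg β) (t : List Bool → ℕ) (b₀ : β) (O : Oracle) (w : List Bool) :
    ∀ (n : ℕ) (as : List (List Bool)), as.length ≤ t w → t w - as.length < n →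
      (M.clockBy t b₀).runAux O w n as = some ((M.runAux O w (t w - as.length) as).getD b₀)
  | 0, _, _, h => absurd h (Nat.not_lt_zero _)
  | n + 1, as, hle, hlt => by
    rw [runAux_succ, clockBy_step]
    by_cases hc : as.length < t w
    · rw [if_pos hc]
      obtain ⟨m, hm⟩ : ∃ m, t w - as.length = m + 1 := ⟨t w - as.length - 1, by omega⟩
      rw [hm, runAux_succ]
      cases M.step w as with
      | inr b => rfl
      | inl y =>
        have h1 : (as ++ [O y]).length ≤ t w := by simp; omega
        have h2 : t w - (as ++ [O y]).length < n := by simp; omega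
        have h3 : t w - (as ++ [O y]).length = m := by simp; omega
        dsimp only
        rw [runAux_clockBy M t b₀ O w n _ h1 h2, h3]
    · rw [if_neg hc]
      have h0 : t w - as.length = 0 := by omega
      rw [h0, runAux_zero]
      rfl

/-- **`M.clockBy t b₀` with fuel `n > t w` outputs `(M.run O (t w) w).getD b₀`.**
[cite: AroraBarak2009, §3.4] -/
theorem run_clockBy (M : OracleAlg β) (t : List Bool → ℕ) (b₀ : β) (O : Oracle) (w : List Bool)
    {n : ℕ} (hn : t w < n) :
    (M.clockBy t b₀).run O n w = some ((M.run O (t w) w).getD b₀) := by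
  have h := runAux_clockBy M t b₀ O w n [] (Nat.zero_le _) (by simpa using hn)
  simpa [run] using h

/-- The queries of the clocked algorithm are among those of `M` (same fuel, same transcript).
[folklore] -/
theorem queriesAux_clockBy_subset (M : OracleAlg β) (t : List Bool → ℕ) (b₀ : β) (O : Oracle)
    (w : List Bool) :
    ∀ (n : ℕ) (as : List (List Bool)) (y : List Bool),
      y ∈ (M.clockBy t b₀).queriesAux O w n as → y ∈ M.queriesAux O w n as
  | 0, _, _, h => by simp at h
  | n + 1, as, y, h => by
    unfold queriesAux at h ⊢
    rw [clockBy_step] at h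
    by_cases hc : as.length < t w
    · rw [if_pos hc] at h
      cases hs : M.step w as with
      | inr b => rw [hs] at h; simp at h
      | inl y' =>
        rw [hs] at h
        dsimp only at h ⊢
        rcases List.mem_cons.1 h with rfl | h
        · exact List.mem_cons_self
        · exact List.mem_cons_of_mem _ (queriesAux_clockBy_subset M t b₀ O w n _ y h)
    · rw [if_neg hc] at h
      simp at h

end ClockBy

/-! ### Clocking by the first component of the input -/

section ClockFst

/-- **Clocking by the first field**: `M.clockFst q b₀` behaves as `M` for `q(|x|)` rounds on an
input `w = ⟨x, r⟩` (`x = (boolUnpair w).1`) and then outputs `b₀` — the clock of an oracle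
adversary, whose round budget is a polynomial in the game input `x` while its step function
reads `⟨x, coins⟩`. [cite: AroraBarak2009, §3.4] -/
def clockFst (M : OracleAlg β) (q : Polynomial ℕ) (b₀ : β) : OracleAlg β :=
  M.clockBy (fun w => q.eval (boolUnpair w).1.length) b₀

/-- The step of `M.clockFst q b₀` (definitional). [folklore] -/
theorem clockFst_step (M : OracleAlg β) (q : Polynomial ℕ) (b₀ : β) (w : List Bool)
    (as : List (List Bool)) :
    (M.clockFst q b₀).step w as =
      if as.length < q.eval (boolUnpair w).1.length then M.step w as else Sum.inr b₀ :=
  rfl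

/-- **Output of `M.clockFst q b₀` on a pair input** `⟨x, r⟩` with fuel `n > q(|x|)`:
`(M.run O (q |x|) ⟨x, r⟩).getD b₀`. [cite: AroraBarak2009, §3.4] -/
theorem run_clockFst_boolPair (M : OracleAlg β) (q : Polynomial ℕ) (b₀ : β) (O : Oracle)
    (x r : List Bool) {n : ℕ} (hn : q.eval x.length < n) :
    (M.clockFst q b₀).run O n (boolPair x r) =
      some ((M.run O (q.eval x.length) (boolPair x r)).getD b₀) := by
  have h := run_clockBy M (fun w => q.eval (boolUnpair w).1.length) b₀ O (boolPair x r)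
    (n := n) (by simpa using hn)
  simpa [clockFst] using h

end ClockFst

/-! ### Polynomial time -/

section PolyTime

variable (eb : Encoding β Bool)

namespace ClockFstPoly

open QueryMapPoly

/-- Stage C of the first-field clock (typed): keep the step result while `|as| < q(|x|)`,
`x = (boolUnpair w).1`, else output `b₀`. [folklore] -/
def stClkFst (q : Polynomial ℕ) (b₀ : β) (r : (List Bool ⊕ β) × (List Bool × List (List Bool))) :
    List Bool ⊕ β :=
  if r.2.2.length < q.eval (boolUnpair r.2.1).1.length then r.1 else Sum.inr b₀

/-- The step of `M.clockFst q b₀` factors through the stages of `OracleQueryMap.lean`. [folklore] -/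
theorem uncurry_clockFst_step (M : OracleAlg β) (q : Polynomial ℕ) (b₀ : β) :
    Function.uncurry (M.clockFst q b₀).step =
      stClkFst q b₀ ∘ Prod.map (Function.uncurry M.step) id ∘ fun p : St => (p, p) := by
  funext p
  obtain ⟨x, as⟩ := p
  simp only [Function.uncurry_apply_pair, Function.comp_apply, stClkFst, Prod.map_apply, id,
    clockFst_step]

/-- `[|as| < q(|(boolUnpair w).1|)]` on `⟨w, LB as⟩`: the test `cClk q` after replacing the
first field by its own first component (`mapFstFn`). [folklore] -/
noncomputable def cClkFst (q : Polynomial ℕ) : List Bool → List Bool :=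
  cClk q ∘ mapFstFn fun z => (boolUnpair z).1

/-- The value of `cClkFst` on a step input. [folklore] -/
theorem cClkFst_apply (q : Polynomial ℕ) (w : List Bool) (as : List (List Bool)) :
    cClkFst q (boolPair w ((encodingList Bool).listBool.encode as)) =
      [decide (as.length < q.eval (boolUnpair w).1.length)] := by
  simp only [cClkFst, Function.comp_apply, mapFstFn_boolPair, cClk_apply]

/-- `cClkFst q` is in `FP`. [folklore] -/
theorem cClkFst_mem_FP (q : Polynomial ℕ) : cClkFst q ∈ FP :=
  comp_mem_FP (cClk_mem_FP q) (mapFstFn_mem_FP boolUnpairFst_mem_FP)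

/-- Stage C of the first-field clock as a string map. [folklore] -/
noncomputable def GClkFst (q : Polynomial ℕ) (b₀ : β) : List (Option Bool) → List Bool :=
  iteFn (cClkFst q ∘ fun z => (boolUnpair z).2) (fun z => (boolUnpair z).1)
    (fun _ => ((encodingList Bool).sumBool eb).encode (Sum.inr b₀)) ∘ fromField.eval

/-- **Stage C of the first-field clock is polynomial-time.** [cite: AroraBarak2009, §3.4 with §1.3] -/
theorem polyTime_stClkFst (q : Polynomial ℕ) (b₀ : β) :
    PolyTimeComputable (encQ eb) ((encodingList Bool).sumBool eb).encode (stClkFst q b₀) := by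
  have hW : (iteFn (cClkFst q ∘ fun z => (boolUnpair z).2) (fun z => (boolUnpair z).1)
      (fun _ => ((encodingList Bool).sumBool eb).encode (Sum.inr b₀))) ∈ FP :=
    iteFn_mem_FP (comp_mem_FP (cClkFst_mem_FP q) boolUnpairSnd_mem_FP) boolUnpairFst_mem_FP
      (const_mem_FP _)
  have hS : PolyTimeComputable (id : List (Option Bool) → _) (id : List Bool → List Bool)
      (GClkFst eb q b₀) :=
    PolyTimeComputable.comp_holds hW fromField.polyTimeComputable_eval
  refine PolyTimeComputable.of_encode hS (encQ eb) (fun _ => rfl) fun r => ?_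
  obtain ⟨r, x, as⟩ := r
  have hin : encIn (x, as) = boolPair x ((encodingList Bool).listBool.encode as) := rfl
  simp only [id, GClkFst, Function.comp_apply, encQ, fromField_eval, hin, stClkFst]
  by_cases hc : as.length < q.eval (boolUnpair x).1.length
  · rw [iteFn_apply_true (by rw [Function.comp_apply, boolUnpair_boolPair, cClkFst_apply]; simp [hc]),
      if_pos hc, boolUnpair_boolPair]
  · rw [iteFn_apply_false (by rw [Function.comp_apply, boolUnpair_boolPair, cClkFst_apply]; simp [hc]),
      if_neg hc]

end ClockFstPoly

open QueryMapPoly ClockFstPoly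

/-- **`M.clockFst q b₀` is polynomial-time** when `M` is. [cite: AroraBarak2009, §3.4 with §1.4.1] -/
theorem isPolyTime_clockFst {M : OracleAlg β} (hM : M.IsPolyTime eb) (q : Polynomial ℕ) (b₀ : β) :
    (M.clockFst q b₀).IsPolyTime eb := by
  unfold IsPolyTime
  rw [uncurry_clockFst_step]
  exact PolyTimeComputable.comp_holds (polyTime_stClkFst eb q b₀)
    (PolyTimeComputable.comp_holds (polyTime_stB eb hM) polyTime_stageA)

end PolyTime

end OracleAlg

end Literature.Computability.Complexity
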